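import Literature.Barriers.ABC.BakerMethodBoundsStewartYu1991LineProofs
import Literature.NumberTheory.DiophantineGeometry.MultiplicativeGroupApproximation
import Mathlib.Analysis.MeanInequalities
import HarnessLib

/-!
# Győry 2008 (Acta Arith. 133) over `ℚ`: the explicit `abc`-type bounds with the GREATEST prime factor

Topic `NumberTheory/DiophantineGeometry`; namespace `Literature.NumberTheory.DiophantineGeometry`
(API in the sub-namespace `Gyory2008`, which names the paper).

Source: K. Győry, *On the abc conjecture in algebraic number fields*, Acta Arith. **133** (2008),
281–295 [Gyory2008] — HELD (`paper:doi-10-4064-aa133-3-6`), read on the page (pp. 281–292).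
Notation of the paper (p. 281–282, 284): `a + b = c` coprime positive integers,
`N = N(a, b, c) = ∏_{p ∣ abc} p` "the greatest square-free factor of `abc`" (the tree's `rad a b c`),
`P(n)` the greatest prime factor of `n` with `P(1) = 1` (the tree's
`Literature.Barriers.ABC.largestPrimeFactor`), `P = P(abc)`, `t` = the number of distinct prime
factors of `abc` (`(a*b*c).primeFactors.card`), `logᵢ` the `i`-th iterate of `log`,
`N⋆ = max(N, 16)`, and "for brevity, we write `log* a` for `max(log a, 1)` if `a > 0`" (p. 282) — the
tree's `Literature.NumberTheory.DiophantineGeometry.Dioph.logStar` (`= max 1 (log a)`, Evertse–Győry's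
notation, REUSED, not re-declared).

This file types the two statements of the paper that concern THE RATIONAL INTEGERS and PROVES the two
displayed consequences the paper draws from them:

* `gyory2008_cor_2_10` — **§2, Corollary, (2.10)** (p. 284), the case `K = ℚ` of Theorem A
  (Győry–Yu [24]): for non-zero integers `A, B, C` and `a, b, c` with `Aa + Bb + Cc = 0`,
  `max(|A|, |B|, |C|) = H`, `|abc| > 1`, "where both `A, B, C` and `a, b, c` are relatively prime",
  `log max(|a|, |b|, |c|) ≤ 2^{10t+22} t⁴ (P / log* P) (∏_{p ∣ abc} log p) log* H`. NAMED FACT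
  (its proof is Győry–Yu 2006, Theorems 1–2, via linear forms in logarithms: XL).
* `gyory2008_thm1_rat` — **§3, Theorem 1 in the case `K = ℚ`**, AS PRINTED on p. 287: "In this
  special situation Theorem 1 gives `log c < 2²³ (P / log* P) N^{653 log₃ N⋆ / log₂ N⋆}`, where
  `P = P(abc)` and `N⋆ = max(N, 16)`. This is comparable with (1.3)." NAMED FACT (Theorem 1 rests on
  Theorem A). This is P. Vojta's `max`-sentence for Stewart–Yu 2001, Theorem 2
  (`z < exp(max{P(x),P(y),P(z)} · G^{C log₃ G⋆ / log₂ G})`, zbMATH Zbl 1036.11032; `P(abc) = max P`)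
  with EXPLICIT constants `2²³, 653` and the extra saving `1 / log* P` — a refereed theorem in print
  independently of the Duke paper [cite: StewartYu2001, Theorem 2] (whose own statement has
  `p′ = min{P(a), P(b), P(c)}`: `Literature.NumberTheory.DiophantineGeometry.stewartYu2001_thm2`, typed
  from (1.3) of this same paper). The kernel link to that `max`-sentence is proved in the companion
  `AbcStewartYu2001GyoryProofs.lean`.
  -- TODO(general form): Theorem 1, (3.7), for an arbitrary number field `K` of degree `d`, unit rank
  `r` and absolute discriminant `Δ_K`: for `a, b, c ∈ K*` with `a + b + c = 0`,
  `log H_K(a, b, c) < c₁₃ Δ_K^{3/2} (log* Δ_K)^{3d−1} (P / log* P) N^{d (c₁₄ log* Δ_K + 19.2 log₃ N⋆) / log₂ N⋆}`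
  with `H_K = ∏_v max(|a|_v, |b|_v, |c|_v)` (3.1) (relative height), `N = N_K(a,b,c) = ∏ N(𝔭)^{ord_𝔭 p}`
  over the finite `v = 𝔭` at which `|a|_v, |b|_v, |c|_v` are not all equal (3.2) — NOT the tree's
  `radicalNorm` (which omits the ramification exponents) — `P = P_K(a,b,c)` the greatest such `N(𝔭)`,
  `c₁₃ = 2²³ (d = 1), 2²⁷ (d = 2, r = 0), 2⁹⁸ d⁸ (log d)⁶ (r = 1), (r+1)^{5r+14} 2^{10r+74} d^{r+8} (log 2d)⁸ (r ≥ 2)`,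
  `c₁₄ = 12.4 (d = 1), 14.7 (d = 2, r = 0), 7.4 d (r = 1), 2.9 d log d (r ≥ 2)` (p. 286; the `d = 1`
  values re-derived on p. 292: "`c₁₃ = 2²³, c₁₄ = 12.4 if d = 1`"); and Theorem 2, (3.9)–(3.10)
  (`log H_K < c₁₆(d, Δ_K, ε) N^{1+ε}`). Left untyped: Győry's `N_K` and `P_K` are not in the tree's
  vocabulary and no consumer exists; the `d = 1` sentence is what bears on the integer `abc` ladder.

PROVED here (the paper's own deductions on p. 287):
* `Gyory2008.eq_3_12_of_cor` — (3.12): (2.10) with `A = B = 1`, `C = −1`, `H = 1` gives, for coprime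
  positive `a + b = c`, `log c ≤ 2^{10t+22} t⁴ (P / log* P) ∏_{p ∣ abc} log p` (printed with `<`; from
  the `≤` of (2.10) one gets `≤`, which is what is proved);
* `Gyory2008.prod_log_le` — the inequality `∏_{p ∣ abc} log p ≤ (log N / t)^t` (AM–GM) used between
  (3.12) and (3.13);
* `Gyory2008.eq_3_13_consequence_of_cor` — (3.13): "whence, using `P ≤ N` and
  `∏_{p ∣ abc} log p ≤ (log N / t)^t`, (3.13) `log c < (2^{10t+22} / t^{t−4}) N (log N)^t` follows"
  (proved with `≤`, the factor written `t⁴ / t^t`).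

Faithfulness notes. (i) "relatively prime" for a triple is rendered as "no prime divides all three".
(ii) `log* ` is `Dioph.logStar = max 1 (log ·)` = the paper's `max(log a, 1)`. (iii) In the `d = 1`
sentence the denominator of the exponent is `log₂ N⋆` as in (3.7) and throughout its proof ((4.14),
(4.16), (4.17), (4.24): "`t < 1.5 d log N / log₂ N⋆`", "`N^{… 19.16 d log₃ N⋆ / log₂ N⋆}`"); the value
`653 = ⌈12.4 / log₃ 16 + 19.2⌉` is `(c₁₄ log* Δ_ℚ + 19.2 log₃ N⋆) ≤ 653 log₃ N⋆` with `log* Δ_ℚ = log* 1 = 1`.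
The placement of `⋆` on both iterated logarithms in the p. 287 display was confirmed on a page render
(`HOME/lit/renders/Gyory2008_p287.png`, abc-stewartyu lit desk g7, 2026-08-26). (iv) "effectively
computable" is automatic here (the constants are explicit). (v) Chim Kwok Chi's
`c₁ = 710` for (1.3) [Gyory2008, p. 282, citing an HKUST M.Phil. thesis] is an unrefereed value and is
not typed. Nothing in this file is, or is reported as, progress on `abc`: these are the explicit
records of the Baker-method `max`-form (cf. `Literature.Barriers.ABC.BakerMethodBounds`).

## References

* [Gyory2008] K. Győry, *On the abc conjecture in algebraic number fields*, Acta Arith. 133 (2008),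
  281–295, doi:10.4064/aa133-3-6 — §2 Corollary (2.10) p. 284; §3 Theorem 1 (3.7) p. 286, the `K = ℚ`
  sentence and (3.12)–(3.13) p. 287; proof §4 pp. 288–292.
* [GyoryYu2006] K. Győry, K. Yu, *Bounds for the solutions of S-unit equations and decomposable form
  equations*, Acta Arith. 123 (2006), 9–41 — Theorems 1–2 (the source of Theorem A).
* [StewartYu2001] C. L. Stewart, K. Yu, *On the abc conjecture, II*, Duke Math. J. 108 (2001),
  169–181 — Theorem 2 (the `min`-form; (1.3) of [Gyory2008]).
* [VojtaZbl103611032] P. Vojta, zbMATH review Zbl 1036.11032 of [StewartYu2001] (the `max`-sentence).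
-/

noncomputable section

open Finset Real
open Literature.Barriers.ABC
open Literature.NumberTheory.DiophantineGeometry.Dioph (logStar logStar_def one_le_logStar)

namespace Literature.NumberTheory.DiophantineGeometry

/-! ### §2, Corollary (2.10): the case `K = ℚ` of Theorem A (Győry–Yu) -/

/-- **Győry 2008, §2 Corollary, (2.10)** (p. 284, verbatim up to notation): *"In the special case
`K = ℚ`, Theorem A implies the following. Let `A, B, C` and `a, b, c` be non-zero rational integers
such that (2.9) `Aa + Bb + Cc = 0` and `max(|A|, |B|, |C|) = H`, `|abc| > 1`, where both `A, B, C`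
and `a, b, c` are relatively prime. Corollary. We have
(2.10) `log max(|a|, |b|, |c|) ≤ 2^{10t+22} t⁴ (P / log* P) (∏_{p ∣ abc} log p) log* H`,
where `P = P(abc)` and `t` denotes the number of distinct prime factors of `abc`."* Here
`log* x = max(log x, 1)` (`Dioph.logStar`), `P(·) = largestPrimeFactor` (`P(1) = 1`), the prime
factors of `abc` are `(abc).natAbs.primeFactors`, and "relatively prime" (for each triple) is "no
prime divides all three". Theorem A is Győry–Yu, Acta Arith. 123 (2006), Theorems 1–2 (linear forms
in logarithms); not proved here. [cite: Gyory2008, §2 Corollary (2.10), p. 284] -/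
def gyory2008_cor_2_10 : Prop :=
  ∀ A B C a b c : ℤ, A ≠ 0 → B ≠ 0 → C ≠ 0 → a ≠ 0 → b ≠ 0 → c ≠ 0 →
    A * a + B * b + C * c = 0 →
    (∀ p : ℕ, p.Prime → ¬ ((p : ℤ) ∣ A ∧ (p : ℤ) ∣ B ∧ (p : ℤ) ∣ C)) →
    (∀ p : ℕ, p.Prime → ¬ ((p : ℤ) ∣ a ∧ (p : ℤ) ∣ b ∧ (p : ℤ) ∣ c)) →
    1 < |a * b * c| →
      Real.log ((max |a| (max |b| |c|) : ℤ) : ℝ) ≤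
        (2 : ℝ) ^ (10 * (a * b * c).natAbs.primeFactors.card + 22) *
          ((a * b * c).natAbs.primeFactors.card : ℝ) ^ 4 *
          ((largestPrimeFactor (a * b * c).natAbs : ℝ) /
            logStar (largestPrimeFactor (a * b * c).natAbs)) *
          (∏ p ∈ (a * b * c).natAbs.primeFactors, Real.log p) *
          logStar ((max |A| (max |B| |C|) : ℤ) : ℝ)

/-! ### §3, Theorem 1 for `K = ℚ` (p. 287) -/

/-- **Győry 2008, Theorem 1 in the case `K = ℚ`**, as printed on p. 287: for coprime positive integers
`a + b = c`, *"In this special situation Theorem 1 gives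
`log c < 2²³ (P / log* P) N^{653 log₃ N⋆ / log₂ N⋆}`, where `P = P(abc)` and `N⋆ = max(N, 16)`. This is
comparable with (1.3)"* [(1.3) = Stewart–Yu 2001, Theorem 2, `log c < p′ N^{c₁ log₃ N⋆ / log₂ N}` with
`p′ = min(P(a), P(b), P(c))`, the tree's `stewartYu2001_thm2`]. Here `N = rad a b c`,
`P(abc) = largestPrimeFactor (a*b*c)` (`= max{P(a), P(b), P(c)}`), `log* = Dioph.logStar`, the power
is `Real.rpow`, and both iterated logarithms are taken at `N⋆ = max(N, 16) > e^e` (so the exponent is a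
positive real; denominator `log₂ N⋆` as in the general (3.7) and its proof, (4.17)/(4.24)). It is the
`d = 1`, `Δ_K = 1`, `r = 0` case (`c₁₃ = 2²³`, `c₁₄ = 12.4`, `12.4 + 19.2 log₃ N⋆ ≤ 653 log₃ N⋆`) of
Theorem 1, (3.7): `log H_K(a,b,c) < c₁₃ Δ_K^{3/2} (log* Δ_K)^{3d−1} (P/log* P) N^{d(c₁₄ log* Δ_K + 19.2 log₃ N⋆)/log₂ N⋆}`
for `a + b + c = 0` in a number field `K` (Győry's `N_K`, `P_K` of (3.2)).
-- TODO(general form): (3.7) for arbitrary `K` (needs Győry's `N_K(a,b,c) = ∏ N(𝔭)^{e_𝔭}` and `P_K`).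
[cite: Gyory2008, §3 Theorem 1 (3.7) p. 286 and the `K = ℚ` sentence p. 287] -/
def gyory2008_thm1_rat : Prop :=
  ∀ a b c : ℕ, IsABCTriple a b c →
    Real.log c < (2 : ℝ) ^ (23 : ℕ) *
      ((largestPrimeFactor (a * b * c) : ℝ) / logStar (largestPrimeFactor (a * b * c))) *
      (rad a b c : ℝ) ^ (653 * Real.log (Real.log (Real.log (max (rad a b c : ℝ) 16))) /
        Real.log (Real.log (max (rad a b c : ℝ) 16)))

namespace Gyory2008

/-! ### Unfolding lemmas -/

/-- Unfolding lemma for `gyory2008_thm1_rat`. [cite: Gyory2008, §3 Theorem 1, `K = ℚ` sentence p. 287] -/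
theorem _root_.Literature.NumberTheory.DiophantineGeometry.gyory2008_thm1_rat_iff :
    gyory2008_thm1_rat ↔ ∀ a b c : ℕ, IsABCTriple a b c →
      Real.log c < (2 : ℝ) ^ (23 : ℕ) *
        ((largestPrimeFactor (a * b * c) : ℝ) / logStar (largestPrimeFactor (a * b * c))) *
        (rad a b c : ℝ) ^ (653 * Real.log (Real.log (Real.log (max (rad a b c : ℝ) 16))) /
          Real.log (Real.log (max (rad a b c : ℝ) 16))) :=
  Iff.rfl

/-- The exponent `653 log₃ N⋆ / log₂ N⋆` is positive (`N⋆ ≥ 16 > e^e`).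
[cite: Gyory2008, §3 Theorem 1, `K = ℚ` sentence p. 287] -/
theorem exponent_pos (N : ℝ) :
    0 < 653 * Real.log (Real.log (Real.log (max N 16))) / Real.log (Real.log (max N 16)) := by
  have h16 : (16 : ℝ) ≤ max N 16 := le_max_right _ _
  have h0 : (0 : ℝ) < max N 16 := by linarith
  -- `e < log 16 = 4 log 2`
  have hlog16 : Real.exp 1 < Real.log 16 := by
    have h4 : Real.log 16 = 4 * Real.log 2 := by
      rw [show (16 : ℝ) = 2 ^ 4 by norm_num, Real.log_pow]; norm_num
    rw [h4]
    have h2 := Real.log_two_gt_d9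
    have he := Real.exp_one_lt_d9
    linarith
  have hlog : Real.exp 1 < Real.log (max N 16) :=
    lt_of_lt_of_le hlog16 (Real.log_le_log (by norm_num) h16)
  have hlogpos : 0 < Real.log (max N 16) := lt_trans (Real.exp_pos 1) hlog
  have hll1 : 1 < Real.log (Real.log (max N 16)) := by
    rw [Real.lt_log_iff_exp_lt hlogpos]; exact hlog
  have hll : 0 < Real.log (Real.log (max N 16)) := by linarith
  have hlll : 0 < Real.log (Real.log (Real.log (max N 16))) := Real.log_pos hll1
  positivity

/-! ### (3.12): the Corollary for `a + b = c` -/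

/-- For an abc triple viewed in `ℤ`: `(a b c : ℤ)`, `|a · b · c| = abc` and the prime factors,
greatest prime factor and their number are those of `abc : ℕ`. [folklore] -/
private theorem natAbs_prod_cast (a b c : ℕ) : ((a : ℤ) * b * c).natAbs = a * b * c := by
  rw [← Nat.cast_mul, ← Nat.cast_mul, Int.natAbs_natCast]

/-- **(3.12)** — "The Corollary in Section 2 implies in this direction that if `a, b, c` are coprime
positive integers with `a + b = c` then `log c < 2^{10t+22} t⁴ (P / log* P) ∏_{p ∣ abc} log p`":
(2.10) with `A = B = 1`, `C = −1` (`H = 1`, `log* H = 1`; `|abc| ≥ 2`; `max(a, b, c) = c`). From the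
`≤` of (2.10) one obtains `≤` (the paper prints `<`). [cite: Gyory2008, p. 287 (3.12)] -/
theorem eq_3_12_of_cor (hG : gyory2008_cor_2_10) {a b c : ℕ} (h : IsABCTriple a b c) :
    Real.log c ≤ (2 : ℝ) ^ (10 * (a * b * c).primeFactors.card + 22) *
        ((a * b * c).primeFactors.card : ℝ) ^ 4 *
        ((largestPrimeFactor (a * b * c) : ℝ) / logStar (largestPrimeFactor (a * b * c))) *
        ∏ p ∈ (a * b * c).primeFactors, Real.log p := by
  obtain ⟨ha, hb, habc, hcop⟩ := h
  have hc : 0 < c := by omega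
  have hcastprod : ((a : ℤ) * b * c) = ((a * b * c : ℕ) : ℤ) := by push_cast; ring
  have h2abc : 2 ≤ a * b * c := by
    have hab : 1 ≤ a * b := Nat.one_le_iff_ne_zero.mpr (by positivity)
    have := Nat.mul_le_mul hab (show 2 ≤ c by omega)
    omega
  have key := hG 1 1 (-1) a b c one_ne_zero one_ne_zero (by norm_num)
    (by exact_mod_cast ha.ne') (by exact_mod_cast hb.ne') (by exact_mod_cast hc.ne')
    (by rw [← habc]; push_cast; ring)
    (fun p hp hdvd => by
      have h1 : (p : ℤ) ∣ 1 := hdvd.1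
      have : p ∣ 1 := by exact_mod_cast h1
      exact hp.one_lt.ne' (Nat.dvd_one.mp this))
    (fun p hp hdvd => by
      have hpa : p ∣ a := by exact_mod_cast hdvd.1
      have hpb : p ∣ b := by exact_mod_cast hdvd.2.1
      exact hp.one_lt.ne' (Nat.eq_one_of_dvd_coprimes hcop hpa hpb))
    (by
      rw [hcastprod, Nat.abs_cast]
      exact_mod_cast h2abc)
  have hmax : (max (|(a : ℤ)|) (max (|(b : ℤ)|) (|(c : ℤ)|)) : ℤ) = (c : ℤ) := by
    rw [Nat.abs_cast, Nat.abs_cast, Nat.abs_cast]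
    have hac : (a : ℤ) ≤ c := by exact_mod_cast (show a ≤ c by omega)
    have hbc : (b : ℤ) ≤ c := by exact_mod_cast (show b ≤ c by omega)
    rw [max_eq_right hbc, max_eq_right hac]
  have hH : (max (|(1 : ℤ)|) (max (|(1 : ℤ)|) (|(-1 : ℤ)|)) : ℤ) = 1 := by norm_num
  rw [hmax, hH, natAbs_prod_cast] at key
  have hlogStar1 : logStar ((1 : ℤ) : ℝ) = 1 := by
    rw [logStar_def]; simp
  rw [hlogStar1, mul_one] at key
  exact_mod_cast key

/-! ### AM–GM for the logarithms of the primes of `abc` (the step from (3.12) to (3.13)) -/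

/-- `∏_{p ∣ n} log p ≤ (log N / t)^t` for `n ≥ 1` with `t ≥ 1` distinct prime factors and
`N = ∏_{p ∣ n} p` its greatest square-free factor (AM–GM: the geometric mean of the `log p` is at most
their arithmetic mean `(∑ log p)/t = log N / t`) — the inequality "`∏_{p ∣ abc} log p ≤ (log N/t)^t`" used
on p. 287 to pass from (3.12) to (3.13). [cite: Gyory2008, p. 287, between (3.12) and (3.13)] -/
theorem prod_log_le {S : Finset ℕ} (hS : ∀ q ∈ S, q.Prime) (hS0 : S.Nonempty) :
    ∏ q ∈ S, Real.log q ≤ (Real.log (∏ q ∈ S, (q : ℝ)) / S.card) ^ S.card := by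
  set t : ℕ := S.card with ht
  have ht0 : 0 < t := Finset.card_pos.mpr hS0
  have htR : (0 : ℝ) < t := by exact_mod_cast ht0
  have hz : ∀ q ∈ S, 0 ≤ Real.log (q : ℝ) := fun q hq =>
    Real.log_nonneg (by exact_mod_cast (hS q hq).one_lt.le)
  -- AM–GM with equal weights `1/t`
  have hamgm := Real.geom_mean_le_arith_mean_weighted S (fun _ => (t : ℝ)⁻¹)
    (fun q => Real.log (q : ℝ)) (fun _ _ => by positivity)
    (by rw [Finset.sum_const, nsmul_eq_mul, ← ht]; field_simp) hz
  -- `∑ (1/t) log q = log N / t`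
  have hsum : ∑ q ∈ S, (t : ℝ)⁻¹ * Real.log (q : ℝ) = Real.log (∏ q ∈ S, (q : ℝ)) / t := by
    rw [← Finset.mul_sum, Real.log_prod (s := S) (f := fun q : ℕ => (q : ℝ))
      (fun q hq => by exact_mod_cast (hS q hq).ne_zero)]
    ring
  rw [hsum] at hamgm
  -- `∏ (log q)^{1/t} = (∏ log q)^{1/t}`
  have hprod : ∏ q ∈ S, Real.log (q : ℝ) ^ (t : ℝ)⁻¹ = (∏ q ∈ S, Real.log (q : ℝ)) ^ (t : ℝ)⁻¹ :=
    Real.finsetProd_rpow S (fun q => Real.log (q : ℝ)) hz _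
  rw [hprod] at hamgm
  have hP0 : 0 ≤ ∏ q ∈ S, Real.log (q : ℝ) := Finset.prod_nonneg hz
  have hA0 : 0 ≤ Real.log (∏ q ∈ S, (q : ℝ)) / t :=
    le_trans (Real.rpow_nonneg hP0 _) hamgm
  -- raise to the `t`-th power
  have hpow := Real.rpow_le_rpow (Real.rpow_nonneg hP0 _) hamgm htR.le
  rw [← Real.rpow_mul hP0, inv_mul_cancel₀ htR.ne', Real.rpow_one, Real.rpow_natCast] at hpow
  exact hpow

/-- **(3.13)** — "whence, using `P ≤ N` and `∏_{p ∣ abc} log p ≤ (log N/t)^t`,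
(3.13) `log c < (2^{10t+22} / t^{t−4}) N (log N)^t` follows": for coprime positive `a + b = c`,
`log c ≤ 2^{10t+22} (t⁴ / t^t) N (log N)^t` (`t = ω(abc) ≥ 1`, `N = rad(abc)`; `1 / log* P ≤ 1`).
Proved with `≤` from the `≤` of (2.10). [cite: Gyory2008, p. 287 (3.13)] -/
theorem eq_3_13_consequence_of_cor (hG : gyory2008_cor_2_10) {a b c : ℕ} (h : IsABCTriple a b c) :
    Real.log c ≤ (2 : ℝ) ^ (10 * (a * b * c).primeFactors.card + 22) *
        (((a * b * c).primeFactors.card : ℝ) ^ 4 / ((a * b * c).primeFactors.card : ℝ) ^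
          (a * b * c).primeFactors.card) *
        (rad a b c : ℝ) * Real.log (rad a b c : ℕ) ^ (a * b * c).primeFactors.card := by
  have h312 := eq_3_12_of_cor hG h
  obtain ⟨ha, hb, habc, hcop⟩ := h
  have hc : 0 < c := by omega
  have h0 : a * b * c ≠ 0 := by positivity
  set S := (a * b * c).primeFactors with hSdef
  set t : ℕ := S.card with ht
  have hS : ∀ q ∈ S, q.Prime := fun q hq => Nat.prime_of_mem_primeFactors hq
  have hS0 : S.Nonempty := by
    rw [hSdef, Nat.nonempty_primeFactors]
    have hab : 1 ≤ a * b := Nat.one_le_iff_ne_zero.mpr (by positivity)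
    have := Nat.mul_le_mul hab (show 2 ≤ c by omega)
    omega
  have ht0 : 0 < t := Finset.card_pos.mpr hS0
  have htR : (0 : ℝ) < t := by exact_mod_cast ht0
  -- `N = ∏_{p ∈ S} p`
  have hrad : ((rad a b c : ℕ) : ℝ) = ∏ q ∈ S, (q : ℝ) := by
    rw [rad_def, Nat.radical_eq_prod_primeFactors]; push_cast; rfl
  -- `P ≤ N` and `log* P ≥ 1`
  have hPmem : largestPrimeFactor (a * b * c) ∈ S := largestPrimeFactor_mem hS0
  have hPle : (largestPrimeFactor (a * b * c) : ℝ) ≤ (rad a b c : ℝ) := by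
    have h1 : largestPrimeFactor (a * b * c) ∣ rad a b c := by
      rw [rad_def, Nat.radical_eq_prod_primeFactors]
      exact Finset.dvd_prod_of_mem _ hPmem
    have h2 : 0 < rad a b c := by rw [rad_def]; exact Nat.radical_pos _
    exact_mod_cast Nat.le_of_dvd h2 h1
  have hP0 : (0 : ℝ) ≤ largestPrimeFactor (a * b * c) := Nat.cast_nonneg _
  have hfrac : (largestPrimeFactor (a * b * c) : ℝ) / logStar (largestPrimeFactor (a * b * c)) ≤
      (rad a b c : ℝ) := by
    have h1 := one_le_logStar (largestPrimeFactor (a * b * c) : ℝ)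
    calc (largestPrimeFactor (a * b * c) : ℝ) / logStar (largestPrimeFactor (a * b * c))
        ≤ (largestPrimeFactor (a * b * c) : ℝ) / 1 :=
          div_le_div_of_nonneg_left hP0 one_pos h1
      _ ≤ (rad a b c : ℝ) := by rw [div_one]; exact hPle
  -- (3.13)
  have h313 : ∏ q ∈ S, Real.log (q : ℝ) ≤ (Real.log (rad a b c : ℕ) / t) ^ t := by
    have := prod_log_le hS hS0
    rwa [← hrad] at this
  have hprod0 : 0 ≤ ∏ q ∈ S, Real.log (q : ℝ) := Finset.prod_nonneg fun q hq =>
    Real.log_nonneg (by exact_mod_cast (hS q hq).one_lt.le)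
  have hA : 0 ≤ (2 : ℝ) ^ (10 * t + 22) * (t : ℝ) ^ 4 := by positivity
  calc Real.log c
      ≤ (2 : ℝ) ^ (10 * t + 22) * (t : ℝ) ^ 4 *
          ((largestPrimeFactor (a * b * c) : ℝ) / logStar (largestPrimeFactor (a * b * c))) *
          ∏ q ∈ S, Real.log (q : ℝ) := h312
    _ ≤ (2 : ℝ) ^ (10 * t + 22) * (t : ℝ) ^ 4 * (rad a b c : ℝ) * (Real.log (rad a b c : ℕ) / t) ^ t := by
        gcongr
    _ = (2 : ℝ) ^ (10 * t + 22) * ((t : ℝ) ^ 4 / (t : ℝ) ^ t) * (rad a b c : ℝ) *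
          Real.log (rad a b c : ℕ) ^ t := by
        rw [div_pow]; field_simp

end Gyory2008

end Literature.NumberTheory.DiophantineGeometry
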